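import Summits.ResolutionOfSingularities.ResolutionOfSingularities.Theorems.FrobeniusClosingPatchingRelPerfectTwoPlanesPlaneFacts
import Summits.ResolutionOfSingularities.ResolutionOfSingularities.Theorems.FrobeniusClosingPatchingRelPerfectPolyShear
import HarnessLib

/-!
# Crux `PatchingRelPerfect` (stmt-ResolutionOfSingularities-16161), chain w52 — the rank-two member
# `f = x₀x₁ + x₂³`: the exceptional curve of the `t`-chart is a graph (facts `hPd`, `hPr`, `hPX`)

[OURS · L1 W5.2 · rung, DESIGN STAGE → instance facts, piece P1 of NEXT-two-planes-cube.md Add. 6]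
On `B_i` (`i ≠ 0, 1`) the three hypotheses of `…TwoPlanesLevelTwo.isRegular_of_isBlowup_tpProd_t`
about `(B_i/(u,e₀))[X] ⧸ (ē₁ + X ē₂³)` (domain, regular, `X ∉`) are DISCHARGED: composing the stage
model `B_i/(u,e₀) ≅ κ[T_j : j ≠ i, 0]` (`chartStageEquiv`, `…TwoPlanesPlaneFacts`) with
`MvPolynomial.mapEquiv` and `MvPolynomial.sumAlgEquiv` identifies `(B_i/(u,e₀))[X]` with
`κ[X, T_j : j ≠ i, 0]` and `ē₁ + X ē₂³` with the GRAPH `T₁ + X·T₂³` (`T₂ := 1` on `B₂`), to which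
`…PolyShear` applies.

* `exists_planeModelEquiv` — the stage model with values `ē_j ↦ T_j`;
* `inr_one_notMem_vars_e2`, `exists_excCurveT_model` — the combined model, `ē₁ + X ē₂³ ↦ T₁ + q`, `T₁ ∉ vars q`;
* `excCurveT_facts` — `hPd ∧ hPr ∧ hPX` on `B_i`, `i ≠ 0, 1`.

Remaining for the member after this file: the `s`-chart facts `hQr`, `hQ0` on `B₂` (`S ē₁ + 1`: Jacobian
route, not a graph), the `B₁` variants, the `B₃` `s`-chart (`A₂` spot) and the companion assembly.
`S` regular local of dimension four with regular system of parameters `x`; nothing here is a statement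
of the manuscript under review.

## References

* The Stacks Project, Tags 0BIQ, 00S9. [StacksProject]
-/

-- `Summit.<Summit>.<Sub>.Theorems` with `Sub = Summit` (single-conjunct summit, D-0017)
set_option linter.dupNamespace false

noncomputable section

open CategoryTheory CategoryTheory.Limits AlgebraicGeometry Literature.AlgebraicGeometry.Resolution
open IsLocalRing

namespace Summit.ResolutionOfSingularities.ResolutionOfSingularities.Theorems

namespace TwoPlanesRung

open ConeRung

universe u

section ExcCurveT

variable {S : Type u} [CommRing S] [IsRegularLocalRing S] (x : Fin 4 → S)
  (hx : Ideal.span (Set.range x) = IsLocalRing.maximalIdeal S)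
  (hd : (IsLocalRing.maximalIdeal S).spanFinrank = 4) (i : Fin 4)

local notation3 "M" => Ideal.span (Set.range x)
local notation3 "B" => chartRing x i
local notation3 "e[" j "]" => chartGen x i j
local notation3 "II" => Ideal.span (Set.range
  (Fin.cons (chartBase x i (x i)) (fun _ : Fin 1 => chartGen x i 0) : Fin 2 → chartRing x i))
local notation3 "κ'" => S ⧸ (Ideal.span (Set.range x) ⊔ ⊥)
local notation3 "σᵢ" => {j : Fin 4 // j ≠ i ∧ j ∉ ({0} : Set (Fin 4))}
local notation3 "σ₁" => {j : Fin 2 // j ≠ Fin.succ 0}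
local notation3 (prettyPrint := false) "PP" => MvPolynomial {j : Fin 2 // j ≠ Fin.succ 0} (chartRing x i ⧸ II)
local notation3 (prettyPrint := false) "gFlat" => (MvPolynomial.C (Ideal.Quotient.mk II (chartGen x i 1)) :
    MvPolynomial {j : Fin 2 // j ≠ Fin.succ 0} (chartRing x i ⧸ II))
  + MvPolynomial.X (⟨0, (Fin.succ_ne_zero 0).symm⟩ : {j : Fin 2 // j ≠ Fin.succ 0}) *
    MvPolynomial.C (Ideal.Quotient.mk II (chartGen x i 2 ^ 3))
local notation3 (prettyPrint := false) "XFlat" => (MvPolynomial.X (⟨0, (Fin.succ_ne_zero 0).symm⟩ : {j : Fin 2 // j ≠ Fin.succ 0}) :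
  MvPolynomial {j : Fin 2 // j ≠ Fin.succ 0} (chartRing x i ⧸ II))
/-- the combined polynomial model `κ[X, T_j : j ≠ i, 0]` of `(B_i/(u,e₀))[X]` -/
local notation3 (prettyPrint := false) "R₂" => MvPolynomial ({j : Fin 2 // j ≠ Fin.succ 0} ⊕ {j : Fin 4 // j ≠ i ∧ j ∉ ({0} : Set (Fin 4))})
  (S ⧸ (Ideal.span (Set.range x) ⊔ ⊥))

omit [IsRegularLocalRing S] in
/-- `1 ∉ {0}` in `Fin 4`. [folklore] -/
theorem one_notMem_zero_set : (1 : Fin 4) ∉ ({0} : Set (Fin 4)) := fun h =>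
  absurd (Set.mem_singleton_iff.mp h) (by decide)

omit [IsRegularLocalRing S] in
/-- `2 ∉ {0}` in `Fin 4`. [folklore] -/
theorem two_notMem_zero_set : (2 : Fin 4) ∉ ({0} : Set (Fin 4)) := fun h =>
  absurd (Set.mem_singleton_iff.mp h) (by decide)

include hx hd in
/-- **The polynomial model of the plane centre, with values**: `B_i/(u, e₀) ≅ κ[T_j : j ≠ i, 0]`,
`ē_j ↦ T_j`. [cite: StacksProject, Tag 0BIQ] -/
theorem exists_planeModelEquiv (hi : i ≠ 0) :
    ∃ ε : (B ⧸ II) ≃+* MvPolynomial σᵢ κ',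
      ∀ (j : Fin 4) (hj : j ≠ i) (hj0 : j ∉ ({0} : Set (Fin 4))),
        ε (Ideal.Quotient.mk II e[j]) = MvPolynomial.X ⟨j, hj, hj0⟩ := by
  have hiT : i ∉ ({0} : Set (Fin 4)) := fun h => hi (Set.mem_singleton_iff.mp h)
  let η := chartStageEquiv x i ⊥ {0} (isQuasiRegular_regularSystemOfParameters hd x hx) hiT
  refine ⟨(Ideal.quotEquivOfEq (chartStageIdeal_zero_eq x i).symm).trans η.symm, fun j hj hj0 => ?_⟩
  rw [RingEquiv.trans_apply, Ideal.quotEquivOfEq_mk, RingEquiv.symm_apply_eq]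
  exact (chartStageEquiv_X x i ⊥ {0} _ hiT ⟨j, hj, hj0⟩).symm

omit [IsRegularLocalRing S] in
/-- In the combined model, the image of `ē₂` does not involve the variable `T₁`
(it is `T₂` if `i ≠ 2` and `1` if `i = 2`). [cite: StacksProject, Tag 0BIQ] -/
theorem inr_one_notMem_vars_e2 (hi1 : i ≠ 1) [Nontrivial κ']
    (ε : (B ⧸ II) ≃+* MvPolynomial σᵢ κ')
    (hε : ∀ (j : Fin 4) (hj : j ≠ i) (hj0 : j ∉ ({0} : Set (Fin 4))),
      ε (Ideal.Quotient.mk II e[j]) = MvPolynomial.X ⟨j, hj, hj0⟩) :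
    (Sum.inr ⟨1, hi1.symm, one_notMem_zero_set⟩ : σ₁ ⊕ σᵢ) ∉
      ((MvPolynomial.sumAlgEquiv (S ⧸ (Ideal.span (Set.range x) ⊔ ⊥)) σ₁ σᵢ).symm
        (MvPolynomial.C (ε (Ideal.Quotient.mk II e[2])))).vars := by
  by_cases hi2 : i = 2
  · have h1 : chartGen x i 2 = 1 := by rw [hi2]; exact chartGen_self x 2
    rw [h1, map_one, map_one, map_one, map_one, ← MvPolynomial.C_1, MvPolynomial.vars_C]
    exact Finset.notMem_empty _
  · rw [hε 2 (Ne.symm hi2) two_notMem_zero_set, MvPolynomial.sumAlgEquiv_symm_C_X, MvPolynomial.vars_X,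
      Finset.mem_singleton]
    intro h
    have h' : (1 : Fin 4) = 2 := congrArg Subtype.val (Sum.inr_injective h)
    exact absurd h' (by decide)

include hx hd in
/-- **The exceptional curve of the `t`-chart is a graph**: there is an isomorphism
`(B_i/(u,e₀))[X] ≅ κ[X, T_j : j ≠ i, 0]` taking `ē₁ + X ē₂³` to `T₁ + q` with `q` free of `T₁` and
`X` to `X`. [cite: StacksProject, Tag 0BIQ] -/
theorem exists_excCurveT_model (hi : i ≠ 0) (hi1 : i ≠ 1) :
    ∃ (E : PP ≃+* R₂) (q : R₂),
      (Sum.inr ⟨1, hi1.symm, one_notMem_zero_set⟩ : σ₁ ⊕ σᵢ) ∉ q.vars ∧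
      E gFlat = MvPolynomial.X (Sum.inr ⟨1, hi1.symm, one_notMem_zero_set⟩) + q ∧
      E XFlat = MvPolynomial.X (Sum.inl ⟨0, (Fin.succ_ne_zero 0).symm⟩) := by
  classical
  haveI : IsDomain κ' := isDomain_residue_sup_bot x hx
  obtain ⟨ε, hε⟩ := exists_planeModelEquiv x hx hd i hi
  let E : PP ≃+* R₂ :=
    (MvPolynomial.mapEquiv σ₁ ε).trans (MvPolynomial.sumAlgEquiv κ' σ₁ σᵢ).symm.toRingEquiv
  let r : R₂ := (MvPolynomial.sumAlgEquiv κ' σ₁ σᵢ).symm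
    (MvPolynomial.C (ε (Ideal.Quotient.mk II e[2])))
  have hEC : ∀ a : B ⧸ II, E (MvPolynomial.C a) =
      (MvPolynomial.sumAlgEquiv κ' σ₁ σᵢ).symm (MvPolynomial.C (ε a)) := fun a => by
    change (MvPolynomial.sumAlgEquiv κ' σ₁ σᵢ).symm (MvPolynomial.mapEquiv σ₁ ε (MvPolynomial.C a)) = _
    rw [MvPolynomial.mapEquiv_apply, MvPolynomial.map_C]
    rfl
  have hEX : E XFlat = MvPolynomial.X (Sum.inl ⟨0, (Fin.succ_ne_zero 0).symm⟩) := by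
    change (MvPolynomial.sumAlgEquiv κ' σ₁ σᵢ).symm (MvPolynomial.mapEquiv σ₁ ε XFlat) = _
    rw [MvPolynomial.mapEquiv_apply, MvPolynomial.map_X, MvPolynomial.sumAlgEquiv_symm_X]
  refine ⟨E, MvPolynomial.X (Sum.inl ⟨0, (Fin.succ_ne_zero 0).symm⟩) * r ^ 3, ?_, ?_, hEX⟩
  · intro h
    rcases Finset.mem_union.mp (MvPolynomial.vars_mul _ _ h) with h1 | h1
    · rw [MvPolynomial.vars_X, Finset.mem_singleton] at h1
      exact Sum.inr_ne_inl h1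
    · exact inr_one_notMem_vars_e2 x i hi1 ε hε (MvPolynomial.vars_pow _ _ h1)
  · rw [map_add, map_mul, hEC, hEC, hEX, hε 1 hi1.symm one_notMem_zero_set,
      MvPolynomial.sumAlgEquiv_symm_C_X, map_pow, map_pow, map_pow, map_pow]

include hx hd in
/-- **The three exceptional-curve facts `hPd`, `hPr`, `hPX` of `…TwoPlanesLevelTwo` hold on
`B_i`, `i ≠ 0, 1`** (transport along the model and `PolyShear`).
[cite: StacksProject, Tag 0BIQ] [cite: StacksProject, Tag 00S9] -/
theorem excCurveT_facts (hi : i ≠ 0) (hi1 : i ≠ 1) :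
    IsDomain (PP ⧸ Ideal.span {gFlat}) ∧ IsRegularRing (PP ⧸ Ideal.span {gFlat}) ∧
      XFlat ∉ Ideal.span {gFlat} := by
  classical
  haveI : IsDomain κ' := isDomain_residue_sup_bot x hx
  haveI : IsRegularRing κ' := isRegularRing_residue_sup_bot x hx
  obtain ⟨E, q, hq, hEg, hEX⟩ := exists_excCurveT_model x hx hd i hi hi1
  have hmap : Ideal.span {MvPolynomial.X (Sum.inr ⟨1, hi1.symm, one_notMem_zero_set⟩ : σ₁ ⊕ σᵢ) + q} =
      (Ideal.span {gFlat}).map (E : PP →+* R₂) := by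
    rw [Ideal.map_span, Set.image_singleton]
    exact congrArg (fun t => Ideal.span {t}) hEg.symm
  let EE := Ideal.quotientEquiv (Ideal.span {gFlat}) _ E hmap
  haveI := PolyShear.isDomain_quot_span_X_add
    (Sum.inr ⟨1, hi1.symm, one_notMem_zero_set⟩ : σ₁ ⊕ σᵢ) hq
  haveI := PolyShear.isRegularRing_quot_span_X_add
    (Sum.inr ⟨1, hi1.symm, one_notMem_zero_set⟩ : σ₁ ⊕ σᵢ) hq
  refine ⟨MulEquiv.isDomain _ EE.toMulEquiv, IsRegularRing.of_ringEquiv (R := R₂ ⧸ Ideal.span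
      {MvPolynomial.X (Sum.inr ⟨1, hi1.symm, one_notMem_zero_set⟩ : σ₁ ⊕ σᵢ) + q}) EE.symm,
    fun h => ?_⟩
  have h1 : E XFlat ∈ (Ideal.span {gFlat}).map (E : PP →+* R₂) := Ideal.mem_map_of_mem _ h
  rw [← hmap, hEX] at h1
  exact PolyShear.X_notMem_span_X_add _ hq (w := Sum.inl ⟨0, (Fin.succ_ne_zero 0).symm⟩)
    Sum.inl_ne_inr h1

end ExcCurveT

end TwoPlanesRung

end Summit.ResolutionOfSingularities.ResolutionOfSingularities.Theorems

end
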